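import Summits.NavierStokesRegularity.NavierStokesRegularity.Theorems.TaoLadderRungTwoFlatHopTubeStatics
import Summits.NavierStokesRegularity.NavierStokesRegularity.Theorems.TaoLadderRungThreeGappedFrontRobustGaussianWeights
import HarnessLib

/-!
# HOP-INVARIANT-50 (image of record numT50/HopInvariant50.lean sha16 2e98d6c2d0715d3a), part 4 — the flat-behind /
  Gaussian-ahead tube weight with its envelope, and the LANDING FORM of the zone clauses (cell harvest/h2-tao-ladder,
  theory-1 g38; landed by p1 g21 with declarations byte-identical (+ five lint docstrings) under namespace `…Theorems.HopTube`;
  helper for item stmt-NavierStokesRegularity-23909 `GradedAdiabaticWake`)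

* `tubeWeight` + `one_le_tubeWeight`, `tubeWeight_behind`, `tubeWeight_grow`, `tubeWeight_tailThin`; `tubeEnv` (+ `_of_le`,
  `_of_lt`); `tubeStatics_tubeWeight` — `TubeStatics` for the concrete weight/envelope from schedule sups alone
  (transporting the tree's `gaussian_weight_T1` / `gaussian_weight_tailThin`);
* `anchorScale_recentre`, `coreClause_recentre`, `nearClause_recentre`, `behindClause_recentre`, `aheadClause_recentre`,
  `captureClause_recentre` — the re-centring `z′ = S(1+·, τ₁)/a` unfolded: each zone clause of `H(n+1)` as ONE
  inequality on the landing state (the exact outputs the per-hop analytic estimates must produce).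

HONEST FRAMING: MODEL lattice (graded mirror table on `S♭`); bookkeeping about the SHAPE of an induction hypothesis;
nothing certified; nothing about the Navier–Stokes equations.
-/

noncomputable section

set_option linter.dupNamespace false

namespace Summit.NavierStokesRegularity.NavierStokesRegularity.Theorems.HopTube

open Set Finset Literature.Analysis.FluidPDE Literature.Analysis.FluidPDE.TaoCascade
/-! ## A concrete weight: flat behind, Gaussian ahead — the statics with the tree's Gaussian weight algebra

`tubeWeight C b k = C` for `k < 0` and `C·2^{k²/2 + b k}` for `k ≥ 0` (`C ≥ 1`, `b ≥ 1/2`): weights `≥ 1`, behind-tame with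
constant `C`, doubling-fast from shell `0` on (`gaussian_weight_T1`), thin-tailed (`gaussian_weight_tailThin`). With the
envelope `tubeEnv` (the shifted tolerance scale `K₀ r²/w(k−1)²` AHEAD of `k₁` only; the growing behind scale
`Eb·(1+ε₀)^{2θ_b|k|}` below it, so that `TubeStepEnvelope` stays satisfiable), `tubeStatics_of_schedule` leaves exactly one
weight hypothesis — the
hand-over inequality `(1+ε₀)^{5(k+2)/2} r w(k+1) ≤ C₄ w_k²` beyond `k₁` — which is `TailThin` at `ϑ := C₄` past its threshold:
the prover chooses `P.k₁` past it. -/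

section GaussianWeights

/-- The tube weight: flat `C` behind, Gaussian `C·2^{k²/2 + b k}` on `k ≥ 0`. [folklore; cell LADDER §50] -/
def tubeWeight (C b : ℝ) (k : ℤ) : ℝ := if 0 ≤ k then C * (2 : ℝ) ^ ((k : ℝ) ^ 2 / 2 + b * k) else C

/-- Ahead (`k ≥ 0`) the tube weight is the Gaussian `C·2^{k²/2 + bk}`. [cite: Tao2016AveragedNS, §6.2 Prop. 6.3 (ix); cell LADDER §50] -/
theorem tubeWeight_of_nonneg (C b : ℝ) {k : ℤ} (hk : 0 ≤ k) :
    tubeWeight C b k = C * (2 : ℝ) ^ ((k : ℝ) ^ 2 / 2 + b * k) := if_pos hk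

/-- Behind (`k < 0`) the tube weight is the constant `C`. [cite: Tao2016AveragedNS, §6.2 Prop. 6.3 (ix); cell LADDER §50] -/
theorem tubeWeight_of_neg (C b : ℝ) {k : ℤ} (hk : k < 0) : tubeWeight C b k = C := if_neg (not_le.mpr hk)

/-- `w ≥ 1` for `C ≥ 1`, `b ≥ 0`. [folklore] -/
theorem one_le_tubeWeight {C b : ℝ} (hC : 1 ≤ C) (hb : 0 ≤ b) (k : ℤ) : 1 ≤ tubeWeight C b k := by
  by_cases hk : 0 ≤ k
  · rw [tubeWeight_of_nonneg C b hk]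
    have hx : (0 : ℝ) ≤ k := by exact_mod_cast hk
    have he : 0 ≤ (k : ℝ) ^ 2 / 2 + b * k := by positivity
    have h2 : (1 : ℝ) ≤ (2 : ℝ) ^ ((k : ℝ) ^ 2 / 2 + b * k) := Real.one_le_rpow (by norm_num) he
    exact le_trans hC (le_mul_of_one_le_right (by linarith) h2)
  · rw [tubeWeight_of_neg C b (lt_of_not_ge hk)]; exact hC

/-- Behind-tameness of the weight: `w k ≤ C·(1+ε₀)^{−k}` for `k ≤ 0`. [folklore] -/
theorem tubeWeight_behind {C b ε₀ : ℝ} (hC : 0 ≤ C) (hε : 0 ≤ ε₀) (k : ℤ) (hk : k ≤ 0) :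
    tubeWeight C b k ≤ C * (1 + ε₀) ^ (-(k : ℝ)) := by
  have hpow : 1 ≤ (1 + ε₀) ^ (-(k : ℝ)) := by
    have hx : (0 : ℝ) ≤ -(k : ℝ) := by
      have : (k : ℝ) ≤ 0 := by exact_mod_cast hk
      linarith
    exact Real.one_le_rpow (by linarith) hx
  have hwk : tubeWeight C b k = C := by
    by_cases h0 : 0 ≤ k
    · have : k = 0 := le_antisymm hk h0
      subst this
      rw [tubeWeight_of_nonneg C b le_rfl]; simp
    · exact tubeWeight_of_neg C b (lt_of_not_ge h0)
  rw [hwk]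
  exact le_mul_of_one_le_right hC hpow

/-- Doubling-fast growth from shell `0` on (tree `gaussian_weight_T1`, transported). [folklore] -/
theorem tubeWeight_grow {C b ε₀ : ℝ} (hε : 0 ≤ ε₀) (hε1 : ε₀ ≤ 1) (hC : 0 < C) (hb : 1 / 2 ≤ b)
    (k : ℤ) (hk : 0 ≤ k) :
    2 * (1 + ε₀) ^ (k : ℝ) * tubeWeight C b k ≤ tubeWeight C b (k + 1) := by
  have h := GappedFrontRobust.gaussian_weight_T1 hε hε1 hC hb
    (fun k : ℤ => C * (2 : ℝ) ^ ((k : ℝ) ^ 2 / 2 + b * k)) (fun _ => rfl) k hk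
  rw [tubeWeight_of_nonneg C b hk, tubeWeight_of_nonneg C b (by omega : 0 ≤ k + 1)]
  simpa using h

/-- Thin tail (tree `gaussian_weight_tailThin`, transported to `k ≥ 0`). [folklore] -/
theorem tubeWeight_tailThin {C b ε₀ r : ℝ} (hε : 0 ≤ ε₀) (hε1 : ε₀ ≤ 1) (hr : 0 ≤ r) (hC : 0 < C) :
    TailThin ε₀ (tubeWeight C b) r := by
  intro ϑ hϑ
  obtain ⟨k₂, hk₂⟩ := GappedFrontRobust.gaussian_weight_tailThin hε hε1 hr hC
    (fun k : ℤ => C * (2 : ℝ) ^ ((k : ℝ) ^ 2 / 2 + b * k)) (fun _ => rfl) ϑ hϑ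
  refine ⟨max k₂ 0, fun k hk => ?_⟩
  have hk0 : 0 ≤ k := le_trans (le_max_right _ _) hk
  have h := hk₂ k (le_trans (le_max_left _ _) hk)
  rw [tubeWeight_of_nonneg C b hk0, tubeWeight_of_nonneg C b (by omega : 0 ≤ k + 1)]
  simpa using h

/-- The TUBE ENVELOPE (piecewise, like the weight): AHEAD of the threshold `k₁` the shifted tolerance scale
`K₀ r²/w(k−1)²` that `TailCompat` pins; on the core and BEHIND the growing scale `Eb·(1+ε₀)^{2θ_b|k|}` — the square of
the behind sup-envelope (rescaled behind energies GROW with depth, as Tao's (ix) envelope `(1+ε₀)^{|k|/10}` does; a flat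
`K₀ r²/w(k−1)² = K₀ r²/C²` behind would make `TubeStepEnvelope` unsatisfiable). The format leaves `env₀` free below `k₁`
(`RestartControlOn` is proved for every envelope). [cite: Tao2016AveragedNS, §6.2 Prop. 6.3 (ix); cell LADDER §50] -/
def tubeEnv (P : TubeSchedule) (ε₀ K₀ r C b Eb : ℝ) : ℤ → ℝ := fun k =>
  if (P.k₁ : ℤ) ≤ k then K₀ * r ^ 2 / tubeWeight C b (k - 1) ^ 2 else Eb * (1 + ε₀) ^ (2 * P.θb * |(k : ℝ)|)

/-- From the tail shell `k₁` on, the envelope is the Gaussian-weight one `K₀r²/w(k−1)²`. [cite: Tao2016AveragedNS, §6.2 Prop. 6.3 (ix); cell LADDER §50.9] -/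
theorem tubeEnv_of_le (P : TubeSchedule) (ε₀ K₀ r C b Eb : ℝ) {k : ℤ} (hk : (P.k₁ : ℤ) ≤ k) :
    tubeEnv P ε₀ K₀ r C b Eb k = K₀ * r ^ 2 / tubeWeight C b (k - 1) ^ 2 := by
  simp [tubeEnv, hk]

/-- Below the tail shell the envelope is `Eb·(1+ε₀)^{2θ_b|k|}`. [cite: Tao2016AveragedNS, §6.2 Prop. 6.3 (ix); cell LADDER §50.9] -/
theorem tubeEnv_of_lt (P : TubeSchedule) (ε₀ K₀ r C b Eb : ℝ) {k : ℤ} (hk : k < (P.k₁ : ℤ)) :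
    tubeEnv P ε₀ K₀ r C b Eb k = Eb * (1 + ε₀) ^ (2 * P.θb * |(k : ℝ)|) := by
  simp [tubeEnv, not_le.mpr hk]

/-- **STATICS WITH THE CONCRETE WEIGHT AND ENVELOPE**: with `w := tubeWeight C b` (`C ≥ 1`, `b ≥ 1/2`, `0 ≤ ε₀ ≤ 1`) and
`env₀ := tubeEnv P ε₀ K₀ r C b Eb` (any `K₀`, `Eb`), `TubeStatics` holds for every schedule with uniform sups whose `k₁ ≥ 1`
lies past the thin-tail threshold for `ϑ := C₄` (hypothesis `hC4` = `tubeWeight_tailThin` instantiated; the prover picks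
`P.k₁` past it). [cite: Tao2016AveragedNS, §6.2 Prop. 6.3 (ix), §6.3–6.4; cell LADDER §50] -/
theorem tubeStatics_tubeWeight (P : TubeSchedule) {ε₀ : ℝ} {i₀ : Fin 2} {X₀ : Fin 2 → ℝ} {r : ℝ}
    {ζ : ℕ → Fin 2 → ℤ → ℝ} {ustar : Fin 2 → ℤ → ℝ} {σ θ₀ θ c₀ c C b K₀ Eb C₄ : ℝ}
    (hε : 0 ≤ ε₀) (hε1 : ε₀ ≤ 1) (hC : 1 ≤ C) (hbw : 1 / 2 ≤ b)
    (hr : 0 < r) (hθ0 : 0 ≤ θ₀) (hθ : θ₀ < θ) (hθh : θ ≤ 1 / 2) (hc0 : 0 < c₀) (hc : c₀ < c) (hσ : 0 < σ)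
    (hk₁ : 1 ≤ P.k₁)
    (hC4 : ∀ k : ℤ, (P.k₁ : ℤ) ≤ k →
      (1 + ε₀) ^ ((5 : ℝ) * (k + 2) / 2) * r * tubeWeight C b (k + 1) ≤ C₄ * tubeWeight C b k ^ 2)
    (hg : 1 ≤ P.g) (hb : 1 ≤ P.b) (hAstar : 0 < P.Astar) (hθb1 : P.θb ≤ 1)
    {Abar δbar ηbar Mζ Mu : ℝ} (hA : ∀ n, 0 ≤ P.A n ∧ P.A n ≤ Abar) (hδ : ∀ n, P.δ n ≤ δbar) (hδ0 : 0 ≤ δbar)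
    (hη : ∀ n, P.η n ≤ ηbar) (hη0 : 0 ≤ ηbar) (hζ : ∀ n i k, |ζ n i k| ≤ Mζ)
    (hu : ∀ i k, -(P.K : ℤ) ≤ k → |ustar i k| ≤ Mu) (hMu : 0 ≤ Mu) :
    TubeStatics P σ ε₀ i₀ X₀ (tubeWeight C b) r θ₀ c₀ (tubeEnv P ε₀ K₀ r C b Eb) ζ ustar θ c := by
  have hC0 : 0 < C := by linarith
  refine tubeStatics_of_schedule (K₀ := K₀) (Cw := C) P hr hθ0 hθ hθh hc0 hc hσ (one_le_tubeWeight hC (by linarith))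
    hk₁ ?_ ?_ hC4 ?_
    hg hb hAstar hε hθb1 hA hδ hδ0 hη hη0 hζ hu hMu
  · intro k hk
    exact tubeWeight_grow hε hε1 hC0 hbw k (by omega)
  · intro k hk; exact (tubeEnv_of_le P ε₀ K₀ r C b Eb hk).le
  · intro k hk
    exact tubeWeight_behind hC0.le hε k hk

end GaussianWeights

/-! ## Landing form of the zone clauses: what the analytic hop estimates must output, in the flow's own variables

The per-hop obligations conclude clauses about the RE-CENTRED state `recentre S τ₁ a = S(1+·, τ₁)/a`. Unfolding the
re-centring once and for all: each clause at hop `n+1` is ONE inequality on the landing state `S(1+·, τ₁)` scaled by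
`a`, with the reference member of the pulse family selected by the landing carrier itself (`(|S i₀ 1 τ₁|/A_*)·u⋆`).
These are the exact targets for the successor's joint `TubeStepCore` + `TubeStepNear` proof (bus l.703), `TubeStepBehind`
(L6), `TubeStepAhead` (tail zone) and `TubeStepCapture` (`a = 1`). -/

section Landing

variable (P : TubeSchedule) {i₀ : Fin 2} {ustar : Fin 2 → ℤ → ℝ} {S : Fin 2 → ℤ → ℝ → ℝ} {τ₁ a : ℝ}

/-- The anchor scale of the re-centred state is `|S i₀ 1 τ₁|/(a·A_*)`. [cite: Tao2016AveragedNS, §6.4 (re-centring); cell LADDER §50 (Landing)] -/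
theorem anchorScale_recentre (i₀ : Fin 2) (S : Fin 2 → ℤ → ℝ → ℝ) (τ₁ : ℝ) {a : ℝ} (ha : 0 < a) :
    anchorScale P i₀ (recentre S τ₁ a) = |S i₀ 1 τ₁| / P.Astar / a := by
  unfold anchorScale recentre
  rw [add_zero, abs_div, abs_of_pos ha]; ring

/-- CORE, landing form: `ω·|S(1+k, τ₁) − (|S i₀ 1 τ₁|/A_*)·u⋆ k| ≤ a·δ(n+1)` on `k ≥ −K`. [cite: Tao2016AveragedNS, §6.3–6.4; cell LADDER §50.8] -/
theorem coreClause_recentre {n : ℕ} (ha : 0 < a)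
    (h : ∀ (i : Fin 2) (k : ℤ), -(P.K : ℤ) ≤ k →
      MirrorPulse.geomGauge P.g P.b i k * |S i (1 + k) τ₁ - |S i₀ 1 τ₁| / P.Astar * ustar i k| ≤ a * P.δ (n + 1)) :
    CoreClause P i₀ ustar (n + 1) (recentre S τ₁ a) := by
  intro i k hk
  rw [anchorScale_recentre P i₀ S τ₁ ha]
  have e : recentre S τ₁ a i k - |S i₀ 1 τ₁| / P.Astar / a * ustar i k =
      (S i (1 + k) τ₁ - |S i₀ 1 τ₁| / P.Astar * ustar i k) / a := by
    unfold recentre; ring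
  rw [e, abs_div, abs_of_pos ha, ← mul_div_assoc, div_le_iff₀ ha]
  calc MirrorPulse.geomGauge P.g P.b i k * |S i (1 + k) τ₁ - |S i₀ 1 τ₁| / P.Astar * ustar i k|
      ≤ a * P.δ (n + 1) := h i k hk
    _ = P.δ (n + 1) * a := mul_comm _ _

/-- NEAR-BEHIND, landing form: the co-moving deviation energy of `S(1+·, τ₁)` from `(|S i₀ 1 τ₁|/A_*)·u⋆` on the block
`[−D, −K−1]` is at most `a²·v(n+1)`. [cite: Tao2016AveragedNS, §6.3–6.4; cell LADDER §49, §50.8] -/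
theorem nearClause_recentre {n : ℕ} (ha : 0 < a)
    (h : ∑ k ∈ Finset.Icc (-(P.D : ℤ)) (-(P.K : ℤ) - 1),
        Real.exp (P.θV * ((k : ℝ) + P.K)) *
          ∑ i : Fin 2, (S i (1 + k) τ₁ - |S i₀ 1 τ₁| / P.Astar * ustar i k) ^ 2 / 2 ≤ a ^ 2 * P.v (n + 1)) :
    NearClause P i₀ ustar (n + 1) (recentre S τ₁ a) := by
  unfold NearClause
  rw [anchorScale_recentre P i₀ S τ₁ ha]
  have ha2 : 0 < a ^ 2 := by positivity
  have e : ∀ (k : ℤ) (i : Fin 2), (recentre S τ₁ a i k - |S i₀ 1 τ₁| / P.Astar / a * ustar i k) ^ 2 / 2 =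
      ((S i (1 + k) τ₁ - |S i₀ 1 τ₁| / P.Astar * ustar i k) ^ 2 / 2) / a ^ 2 := by
    intro k i
    have e1 : recentre S τ₁ a i k - |S i₀ 1 τ₁| / P.Astar / a * ustar i k =
        (S i (1 + k) τ₁ - |S i₀ 1 τ₁| / P.Astar * ustar i k) / a := by
      unfold recentre; ring
    rw [e1, div_pow]; ring
  have hsum : (∑ k ∈ Finset.Icc (-(P.D : ℤ)) (-(P.K : ℤ) - 1), Real.exp (P.θV * ((k : ℝ) + P.K)) *
        ∑ i : Fin 2, (recentre S τ₁ a i k - |S i₀ 1 τ₁| / P.Astar / a * ustar i k) ^ 2 / 2) =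
      (∑ k ∈ Finset.Icc (-(P.D : ℤ)) (-(P.K : ℤ) - 1), Real.exp (P.θV * ((k : ℝ) + P.K)) *
        ∑ i : Fin 2, (S i (1 + k) τ₁ - |S i₀ 1 τ₁| / P.Astar * ustar i k) ^ 2 / 2) / a ^ 2 := by
    rw [Finset.sum_div]
    refine Finset.sum_congr rfl (fun k _ => ?_)
    rw [mul_div_assoc, Finset.sum_div]
    congr 1
    exact Finset.sum_congr rfl (fun i _ => e k i)
  rw [hsum, div_le_iff₀ ha2]
  linarith

/-- BEHIND, landing form: `|S(1+k, τ₁)| ≤ a·A(n+1)·(1+ε₀)^{θ_b min(|k|, n+1+K₂)}` on `k < −K`. [cite: Tao2016AveragedNS, §6.3–6.4; cell LADDER §47.5 L6, §50.8] -/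
theorem behindClause_recentre {ε₀ : ℝ} {n : ℕ} (ha : 0 < a)
    (h : ∀ (i : Fin 2) (k : ℤ), k < -(P.K : ℤ) →
      |S i (1 + k) τ₁| ≤ a * (P.A (n + 1) * (1 + ε₀) ^ (P.θb * min |(k : ℝ)| (((n + 1 : ℕ) : ℝ) + P.K₂)))) :
    BehindClause P ε₀ (n + 1) (recentre S τ₁ a) := by
  intro i k hk
  unfold recentre
  rw [abs_div, abs_of_pos ha, div_le_iff₀ ha]
  calc |S i (1 + k) τ₁| ≤ _ := h i k hk
    _ = P.A (n + 1) * (1 + ε₀) ^ (P.θb * min |(k : ℝ)| (((n + 1 : ℕ) : ℝ) + P.K₂)) * a := mul_comm _ _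

/-- AHEAD, landing form: `8·w k·|S(1+k, τ₁)| ≤ a·r` from shell `k₁` on. [cite: Tao2016AveragedNS, §6.2 Prop. 6.3 (ix); cell LADDER §47.5 L1, §50.8] -/
theorem aheadClause_recentre {w : ℤ → ℝ} {r : ℝ} (ha : 0 < a)
    (h : ∀ (i : Fin 2) (k : ℤ), (P.k₁ : ℤ) ≤ k → 8 * (w k * |S i (1 + k) τ₁|) ≤ a * r) :
    AheadClause P w r (recentre S τ₁ a) := by
  intro i k hk
  unfold recentre
  rw [abs_div, abs_of_pos ha]
  have h1 := h i k hk
  have e : 8 * (w k * (|S i (1 + k) τ₁| / a)) = 8 * (w k * |S i (1 + k) τ₁|) / a := by ring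
  rw [e, div_le_iff₀ ha]
  linarith [mul_comm a r]

/-- CAPTURE, landing form (`a = 1`): `|S(1+k, τ₁) − ζ(n+1) k| ≤ η(n+1)`. [cite: Tao2016AveragedNS, §6.3–6.4; cell LADDER §47.5 L3, §50.8] -/
theorem captureClause_recentre {ζ : ℕ → Fin 2 → ℤ → ℝ} {n : ℕ}
    (h : ∀ (i : Fin 2) (k : ℤ), |S i (1 + k) τ₁ - ζ (n + 1) i k| ≤ P.η (n + 1)) :
    CaptureClause P ζ (n + 1) (recentre S τ₁ 1) := by
  intro i k
  unfold recentre
  rw [div_one]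
  exact h i k

end Landing

end Summit.NavierStokesRegularity.NavierStokesRegularity.Theorems.HopTube

end
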